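import Literature.MathematicalPhysics.QuantumLattice.HubbardFermiLiquid
import Literature.MathematicalPhysics.QuantumLattice.HubbardGaugeBound
import Literature.MathematicalPhysics.QuantumLattice.ApproximatingHamiltonianProofs
import HarnessLib

/-!
# A priori bound on the finite-volume two-point function of `bgm_two_point_limit`:
`|⟨c†_{xσ} c_{yσ'}⟩_{β,L}| ≤ 1`, hence subsequential thermodynamic limits always exist

Sibling proof file of `HubbardFermiLiquid.lean` (named fact `bgm_two_point_limit`,
Benfatto–Giuliani–Mastropietro 2006, Thm. 1.1: convergence of the finite-volume thermal two-point
functions `hubbardThermalTwoPoint β U μ L x y σ σ'` as `L → ∞`). The finite-volume Gibbs state is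
a state and `‖c†_{xσ} c_{yσ'}‖ ≤ 1`, so the sequence in the fact is bounded by `1` for ALL
parameters (`norm_hubbardThermalTwoPoint_le_one`); by Bolzano–Weierstrass it always has
convergent subsequences (`exists_tendsto_subseq_hubbardThermalTwoPoint`). The content of the fact
is therefore exactly the UNIQUENESS of the limit point along the full sequence of volumes — which is
what the expansions prove where they converge (high temperature:
`HubbardHighTemperatureTwoPoint.lean`; `U = 0`: `HubbardFreePropagatorLimit.lean`; the regime
`β ≤ e^{a/|U|}` of Thm. 1.1 is Benfatto–Giuliani–Mastropietro's renormalisation group).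
Everything is PROVED; no definition, no named fact.

## References

* G. Benfatto, A. Giuliani, V. Mastropietro, Ann. Henri Poincaré 7 (2006) 809–898, §1.2 (1.2)
  (the Schwinger functions of the finite-volume Gibbs state). [BenfattoGiulianiMastropietro2006]
* O. Bratteli, D. W. Robinson, *Operator Algebras and QSM II*, §5.3.1 (Gibbs states are states:
  `|ω(A)| ≤ ‖A‖`). [BratteliRobinsonII1997]
-/

noncomputable section

open scoped Matrix.Norms.L2Operator
open Filter Matrix Literature.Probability.LatticeModels
open scoped _root_.Topology

namespace Literature.MathematicalPhysics.QuantumLattice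

section Graph

variable {Λ : Type*} [LinearOrder Λ] [Fintype Λ] (G : SimpleGraph Λ) [DecidableRel G.Adj]

/-- **States are bounded by the norm of the observable**: on any finite graph and for all real
parameters, `|⟨c†_{uσ} c_{vσ'}⟩_{β, H_G(t,U) - μN}| ≤ ‖c†_{uσ}‖ ‖c_{vσ'}‖ ≤ 1`.
[cite: BratteliRobinsonII1997, §5.3.1 (Gibbs states are states)] -/
theorem norm_thermalCorr_creation_annihilation_le_one (β t U μ : ℝ) (u v : Λ) (σ σ' : Fin 2) :
    ‖Matrix.thermalCorr β (hamiltonianWith G t U μ) (creation (orb u σ)) (annihilation (orb v σ'))‖ ≤ 1 := by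
  rw [Matrix.thermalCorr]
  refine (norm_gibbsState_le (isHermitian_hamiltonianWith G t U μ) β _).trans ?_
  calc ‖creation (orb u σ) * annihilation (orb v σ')‖
      ≤ ‖(creation (orb u σ) : Matrix (Finset (Orb Λ)) (Finset (Orb Λ)) ℂ)‖ * ‖annihilation (orb v σ')‖ := l2_opNorm_mul _ _
    _ ≤ 1 * 1 := mul_le_mul (norm_creation_le_one _) (norm_annihilation_le_one _) (norm_nonneg _) zero_le_one
    _ = 1 := one_mul 1

end Graph

/-- **A priori bound on the two-point function of the fact `bgm_two_point_limit`**: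
`|⟨c†_{xσ} c_{yσ'}⟩_{β,L}| ≤ 1` for all `β, U, μ, L, x, y, σ, σ'` (junk value `0` at `L = 0`).
[cite: BenfattoGiulianiMastropietro2006, §1.2 eq. (1.2)] -/
theorem norm_hubbardThermalTwoPoint_le_one (β U μ : ℝ) (L : ℕ) (x y : Site 2) (σ σ' : Fin 2) :
    ‖hubbardThermalTwoPoint β U μ L x y σ σ'‖ ≤ 1 := by
  unfold hubbardThermalTwoPoint
  split_ifs with hL
  · rw [norm_zero]; exact zero_le_one
  · haveI : NeZero L := ⟨hL⟩
    -- `convert`, not `exact`: the instance terms synthesised inside the definition of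
    -- `hubbardThermalTwoPoint` differ syntactically from those of the general lemma
    convert norm_thermalCorr_creation_annihilation_le_one (fermionTorusGraph 2 L) β 1 U μ
      (FermionTorus.ofTorusSite (Torus.proj L x)) (FermionTorus.ofTorusSite (Torus.proj L y)) σ σ' using 3
    rfl

/-- **Subsequential thermodynamic limits always exist** (Bolzano–Weierstrass): for all parameters
there are `S` with `|S| ≤ 1` and a strictly increasing sequence of volumes along which
`⟨c†_{xσ} c_{yσ'}⟩_{β,L} → S`. The fact `bgm_two_point_limit` asserts, in the regime of
Benfatto–Giuliani–Mastropietro's Thm. 1.1, the uniqueness of this limit point along ALL volumes.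
[cite: BenfattoGiulianiMastropietro2006, Thm. 1.1 ("in the limit L = ∞")] -/
theorem exists_tendsto_subseq_hubbardThermalTwoPoint (β U μ : ℝ) (x y : Site 2) (σ σ' : Fin 2) :
    ∃ S : ℂ, ‖S‖ ≤ 1 ∧ ∃ φ : ℕ → ℕ, StrictMono φ ∧
      Tendsto (fun n => hubbardThermalTwoPoint β U μ (φ n) x y σ σ') atTop (𝓝 S) := by
  obtain ⟨S, hS, φ, hφ, hlim⟩ := tendsto_subseq_of_bounded (Metric.isBounded_closedBall (x := (0 : ℂ)) (r := 1))
    (x := fun L : ℕ => hubbardThermalTwoPoint β U μ L x y σ σ')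
    (fun L => mem_closedBall_zero_iff.2 (norm_hubbardThermalTwoPoint_le_one β U μ L x y σ σ'))
  refine ⟨S, ?_, φ, hφ, hlim⟩
  rw [Metric.closure_closedBall, mem_closedBall_zero_iff] at hS
  exact hS

end Literature.MathematicalPhysics.QuantumLattice

end
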